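import Summits.Parity.BatemanHorn.Theorems.AlmostPrimeZerosSystemMomentDeficitK1OfRoughClassDeficit

/-!
# Crux `SystemMomentDeficit` (stmt-Parity-11326), line `Ideator3Sketch`: bridge 1 under its registered stub name

The reshaped skeleton `Cruxes/SystemMomentDeficit/Lines/Ideator3Sketch.lean` (lead c1) registers bridge 1
(RCD → K1) under the `stub_`-name `stub_decorrelatedCovarianceBound_of_roughClassDeficit`; it is the landed
theorem `decorrelatedCovarianceBound_of_roughClassDeficit` (`…K1OfRoughClassDeficit.lean`, p105789).  This file
closes that registered stub by name.  [folklore]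
-/

namespace Summit.Parity.BatemanHorn.Cruxes.SystemMomentDeficit.Ideator3Sketch

open scoped BigOperators
open Finset Polynomial
open Literature.NumberTheory.Sieve

/-- **Bridge 1 (registered stub name): the rough-class deficit bound RCD implies the decorrelated covariance
bound K1**, verbatim the registered stub `stub_decorrelatedCovarianceBound_of_roughClassDeficit` of line
`Ideator3Sketch`; proof: `decorrelatedCovarianceBound_of_roughClassDeficit`. -/
theorem stub_decorrelatedCovarianceBound_of_roughClassDeficit :
    (∀ (k : ℕ) (f : Fin k → ℤ[X]), IsBatemanHornSystem f → ∃ C : ℝ, ∀ x : ℕ, 16 ≤ x →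
      ∀ q ∈ (Nat.primesLE (Nat.sqrt (Nat.sqrt x)) ∪
          ((Nat.primesLE (Nat.sqrt (Nat.sqrt x))).filter
            (fun p => p ^ 2 ≤ Nat.sqrt (Nat.sqrt x))).image (fun p => p ^ 2)),
        -(C * ArithmeticFunction.vonMangoldt q / ((q : ℝ) * Real.log x)) ≤
          ∑ i, ((∑ n ∈ (Finset.range (x + 1)).filter
                  (fun n : ℕ => q ∣ ((f i).eval (n : ℤ)).toNat ∧ ((f i).eval (n : ℤ)).toNat ≠ 0),
                (((∑ j, (((f j).eval (n : ℤ)).toNat.factorization.sum fun _ v => min v 2) : ℕ) : ℝ) -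
                  ((∑ j, #((Nat.primesLE x ∪ ((Nat.primesLE x).filter (fun p => p ^ 2 ≤ x)).image
                      (fun p => p ^ 2)).filter
                    (fun r => r ∣ ((f j).eval (n : ℤ)).toNat ∧ ((f j).eval (n : ℤ)).toNat ≠ 0)) : ℕ) :
                    ℝ))) /
                ((x : ℝ) + 1) -
            (#((Finset.range (x + 1)).filter
                (fun n : ℕ => q ∣ ((f i).eval (n : ℤ)).toNat ∧ ((f i).eval (n : ℤ)).toNat ≠ 0)) : ℝ) /
                ((x : ℝ) + 1) *
              ((∑ n ∈ Finset.range (x + 1),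
                  (((∑ j, (((f j).eval (n : ℤ)).toNat.factorization.sum fun _ v => min v 2) : ℕ) : ℝ) -
                    ((∑ j, #((Nat.primesLE x ∪ ((Nat.primesLE x).filter (fun p => p ^ 2 ≤ x)).image
                        (fun p => p ^ 2)).filter
                      (fun r => r ∣ ((f j).eval (n : ℤ)).toNat ∧ ((f j).eval (n : ℤ)).toNat ≠ 0)) : ℕ) :
                      ℝ))) /
                ((x : ℝ) + 1)))) →
    ∀ (k : ℕ) (f : Fin k → ℤ[X]), IsBatemanHornSystem f → ∃ C : ℝ, ∀ x : ℕ, 16 ≤ x →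
      -C ≤
        (∑ n ∈ Finset.range (x + 1),
            (∑ i, ∑ q ∈ (Nat.primesLE (Nat.sqrt (Nat.sqrt x)) ∪
                ((Nat.primesLE (Nat.sqrt (Nat.sqrt x))).filter
                  (fun p => p ^ 2 ≤ Nat.sqrt (Nat.sqrt x))).image (fun p => p ^ 2)).filter
                (fun q => q ∣ ((f i).eval (n : ℤ)).toNat ∧ ((f i).eval (n : ℤ)).toNat ≠ 0),
              (1 - 2 * ArithmeticFunction.vonMangoldt q / Real.log (Nat.sqrt (Nat.sqrt x)))) *
            (((∑ i, (((f i).eval (n : ℤ)).toNat.factorization.sum fun _ v => min v 2) : ℕ) : ℝ) -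
              ((∑ i, #((Nat.primesLE x ∪ ((Nat.primesLE x).filter (fun p => p ^ 2 ≤ x)).image
                  (fun p => p ^ 2)).filter
                (fun q => q ∣ ((f i).eval (n : ℤ)).toNat ∧ ((f i).eval (n : ℤ)).toNat ≠ 0)) : ℕ) : ℝ))) /
            ((x : ℝ) + 1) -
          (∑ n ∈ Finset.range (x + 1),
              (∑ i, ∑ q ∈ (Nat.primesLE (Nat.sqrt (Nat.sqrt x)) ∪
                  ((Nat.primesLE (Nat.sqrt (Nat.sqrt x))).filter
                    (fun p => p ^ 2 ≤ Nat.sqrt (Nat.sqrt x))).image (fun p => p ^ 2)).filter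
                  (fun q => q ∣ ((f i).eval (n : ℤ)).toNat ∧ ((f i).eval (n : ℤ)).toNat ≠ 0),
                (1 - 2 * ArithmeticFunction.vonMangoldt q / Real.log (Nat.sqrt (Nat.sqrt x))))) /
              ((x : ℝ) + 1) *
            ((∑ n ∈ Finset.range (x + 1),
                (((∑ i, (((f i).eval (n : ℤ)).toNat.factorization.sum fun _ v => min v 2) : ℕ) : ℝ) -
                  ((∑ i, #((Nat.primesLE x ∪ ((Nat.primesLE x).filter (fun p => p ^ 2 ≤ x)).image
                      (fun p => p ^ 2)).filter
                    (fun q => q ∣ ((f i).eval (n : ℤ)).toNat ∧ ((f i).eval (n : ℤ)).toNat ≠ 0)) : ℕ) :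
                    ℝ))) /
              ((x : ℝ) + 1)) :=
  decorrelatedCovarianceBound_of_roughClassDeficit

end Summit.Parity.BatemanHorn.Cruxes.SystemMomentDeficit.Ideator3Sketch
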